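import Summits.CriticalPhenomena.SAWScalingLimit.Theses.SAWDefectDecoherence
import Literature.Probability.RandomPlanarGeometry.ConformalRestrictionProofs

/-!
# Sketch for crux idea `subdomain-conditioning-transfer` (crux stmt-CriticalPhenomena-14005,
`ObservableToSLER`; crux-ideate round 1, ideator 1 / gen 2)

Lever: EXACT SUB-DOMAIN CONDITIONING of the `x_c`-weighted hexagonal SAW (the law of the walk of a
sub-domain `Ω'_δ ⊆ Ω_δ` with the same endpoints is the law in `Ω_δ` conditioned on the range event
"stays in `Ω'_δ`") evaluated against FIXED range events of explicit SLE₈⁄₃-probability: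

* (A) OUTER STABILITY for the gate/renewal lines: an approach of flat-pinned carriers FROM OUTSIDE
  (the one case the admissible-family quantifier of `HexObservableLimitR` does not absorb) is turned
  into an approach from inside by a LATTICE TRANSLATION (rows stay exact rows) with zero component
  along the other marked point's inward normal, followed by conditioning from a FATTENED FIXED
  carrier on the fixed open event `{range ⊆ T}` whose SLE₈⁄₃-probability tends to `1`
  (`IsSLELaw.hullRestriction_eightThirds` + Radó) — no collar-negligibility input.
* (B) OSCULATING ROOTS: at a marked prime end where `∂D` is one-sidedly tangent to a lattice line
  with Dini contact, `D` is a sub-domain of a flat-pinned `D⁺` and SLE₈⁄₃(D⁺) stays in `D̄` with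
  POSITIVE probability (angular derivative, Kellogg–Warschawski), so the carving is non-singular.

Everything below is a `Prop` (statement shapes); nothing is asserted.
-/

noncomputable section

open Literature.Probability.RandomPlanarGeometry Literature.Probability.RandomPlanarGeometry.SAW
  Literature.Probability.LatticeModels MeasureTheory Filter Topology Set
open scoped NNReal ENNReal

namespace Summit.CriticalPhenomena.SAWScalingLimit.Cruxes.ObservableToSLER.SubdomainConditioning

/-! ## §1 The exact identity (FIRST LEMMA) -/

/-- The range event "the walk of `Ω_δ` is a walk of the sub-domain graph `Ω'_δ`": every edge it uses
is an edge of `hexDomainGraph Ω' δ`. -/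
def StaysIn (Ω' Ω : Set ℂ) (δ : ℝ) (a b : HexVertex) : Set (HexDomainSAW Ω δ a b) :=
  {γ | ∀ e ∈ γ.walk.edges, e ∈ (hexDomainGraph Ω' δ).edgeSet}

/-- Inclusion of the SAWs of a sub-domain graph along a graph inclusion `Ω'_δ ≤ Ω_δ`
(`Walk.mapLe`; self-avoidance is preserved, `IsPath.mapLe`). -/
def inclSAW {Ω' Ω : Set ℂ} {δ : ℝ} (h : hexDomainGraph Ω' δ ≤ hexDomainGraph Ω δ)
    {a b : HexVertex} (γ : HexDomainSAW Ω' δ a b) : HexDomainSAW Ω δ a b :=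
  ⟨γ.walk.mapLe h, γ.isPath.mapLe h⟩

/-- **FIRST LEMMA — exact sub-domain conditioning (weights).** Pushing the critical SAW weight
`x_c^{ℓ(γ)}` of `Ω'_δ` forward along the inclusion gives exactly the SAW weight of `Ω_δ` restricted
to the walks that stay in `Ω'_δ` (the inclusion is a weight-preserving bijection onto `StaysIn`:
`ℓ` is the vertex count, unchanged by `mapLe`). LSW 2004 §3.4.5 ("restriction property" of the
`μ^{-|ω|}`-weighted SAW), at the level of the tree's `hexSAWWeight`. -/
def ExactSubdomainConditioning : Prop :=
  ∀ (Ω' Ω : Set ℂ) (δ : ℝ) (a b : HexVertex) (h : hexDomainGraph Ω' δ ≤ hexDomainGraph Ω δ),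
    (hexSAWWeight Ω' δ a b).map (inclSAW h) = (hexSAWWeight Ω δ a b).restrict (StaysIn Ω' Ω δ a b)

/-- The same for the normalised laws: `P^{Ω'}_δ = P^{Ω}_δ( · | stays in Ω'_δ)` whenever the
conditioning event has positive (finite) weight. -/
def SubdomainConditioningLaw : Prop :=
  ∀ (Ω' Ω : Set ℂ) (δ : ℝ) (a b : HexVertex) (h : hexDomainGraph Ω' δ ≤ hexDomainGraph Ω δ),
    hexSAWWeight Ω δ a b (StaysIn Ω' Ω δ a b) ≠ 0 → hexSAWWeight Ω δ a b Set.univ ≠ ∞ →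
      (hexSAWLaw Ω' δ a b).map (inclSAW h) =
        ProbabilityTheory.cond (hexSAWLaw Ω δ a b) (StaysIn Ω' Ω δ a b)

/-- The inclusion does not change the curve class (same vertex list, same polyline). -/
def CurveIncl : Prop :=
  ∀ (Ω' Ω : Set ℂ) (δ : ℝ) (a b : HexVertex) (h : hexDomainGraph Ω' δ ≤ hexDomainGraph Ω δ)
    (γ : HexDomainSAW Ω' δ a b), (inclSAW h γ).curve = γ.curve

/-- For sets `Ω' ⊆ Ω` the graph inclusion holds as soon as the main mesh component of `Ω'` lies in
the main mesh component of `Ω` (automatic eventually for nested Jordan carriers; the only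
non-monotone ingredient of `embMeshDomain` is the choice of the largest component). -/
def GraphInclOfSubset : Prop :=
  ∀ (Ω' Ω : Set ℂ) (δ : ℝ), Ω' ⊆ Ω →
    embMeshDomain hexGraph hexCenter Ω' δ ⊆ embMeshDomain hexGraph hexCenter Ω δ →
      hexDomainGraph Ω' δ ≤ hexDomainGraph Ω δ

/-! ## §2 Lattice translations (the re-embedding that keeps exact rows exact) -/

/-- Translation of honeycomb vertices by a vector of the underlying `ℤ²` (cell) lattice. -/
def shiftV (u : Site 2) (v : HexVertex) : HexVertex := (v.1 + u, v.2)

/-- **Translation covariance of the critical hexagonal SAW law**: translating the carrier by the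
embedded lattice vector `δ · triEmbed u` and the endpoints by `u` translates the law of the curve
(`hexCenter (x + u, t) = hexCenter (x, t) + triEmbed u`, `triEmbed_add`; the canonical
discretisation, the weights `x_c^{ℓ}` and the polyline are all equivariant). Rows `{v | m ≤ v.1 1}`
go to rows `{v | m + u 1 ≤ v.1 1}`: an exact half-lattice ball stays an exact half-lattice ball. -/
def TranslationCovariance : Prop :=
  ∀ (Ω : Set ℂ) (δ : ℝ) (u : Site 2) (a b : HexVertex) (f : CurveClass ℂ → ℝ),
    let c : ℂ := (δ : ℂ) * triEmbed u
    let τ : C(ℂ, ℂ) := ⟨fun z => z + c, continuous_id.add continuous_const⟩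
    ∫ γ, f γ.curve ∂(hexSAWLaw ((fun z => z + c) '' Ω) δ (shiftV u a) (shiftV u b)) =
      ∫ γ, f (CurveClass.map τ γ.curve) ∂(hexSAWLaw Ω δ a b)

/-! ## §3 The two soft limit lemmas of the scheme -/

/-- Conditioning on events of asymptotically full probability does not move bounded statistics
(total variation `≤ 2 (1 - P(E))`). -/
def ConditioningOnLargeEvents : Prop :=
  ∀ (X : Type) [MeasurableSpace X] (P : ℕ → Measure X) (E : ℕ → Set X),
    (∀ n, IsProbabilityMeasure (P n)) → (∀ n, MeasurableSet (E n)) →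
    Tendsto (fun n => P n (E n)) atTop (𝓝 1) →
    ∀ g : X → ℝ, (∃ C : ℝ, ∀ x, |g x| ≤ C) → Measurable g →
      Tendsto (fun n => (∫ x, g x ∂(ProbabilityTheory.cond (P n) (E n))) - ∫ x, g x ∂(P n))
        atTop (𝓝 0)

/-- "Range inside an OPEN set" is an open event of `CurveClass ℂ` (the range of a class is compact),
so portmanteau gives `liminf P_n {range ⊆ O} ≥ P {range ⊆ O}` along any weak limit. (The tree has
the closed version `CurveClass.isClosed_rangeSubset`.) -/
def RangeSubsetOpen : Prop :=
  ∀ O : Set ℂ, IsOpen O → IsOpen (CurveClass.rangeSubset O)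

/-- The continuum input of (A): for SLE₈⁄₃ laws, the probability of staying in a hull subdomain
tends to `1` as the removed hull shrinks to the boundary away from the marked points — here in the
minimal sequential form used by the scheme (nested hull subdomains exhausting `D`). Source:
`IsSLELaw.hullRestriction_eightThirds` (restriction formula `Φ'_A(0)^{5/8}`) with the continuity of
`A ↦ Φ'_A(0)` under shrinking (`RestrictionContinuity` / Radó in tree). -/
def ThinHullProbabilityToOne : Prop :=
  ∀ (D : DobrushinDomain) (Dk : ℕ → DobrushinDomain) (μ : Measure (CurveClass ℂ)),
    IsSLELaw ((8 : ℝ≥0) / 3) D μ →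
    (∀ k, D.IsHullSubdomain (Dk k)) →
    (∀ k, (Dk k).carrier ⊆ (Dk (k + 1)).carrier) →
    (∀ K : Set ℂ, IsCompact K → K ⊆ D.carrier → ∃ k, K ⊆ (Dk k).carrier) →
      Tendsto (fun k => μ (CurveClass.rangeSubset (closure (Dk k).carrier))) atTop (𝓝 1)

/-! ## §4 (B) Osculating roots -/

/-- **Non-singular tangential carving (continuum).** `D ⊆ D⁺` Dobrushin with the same marked
points, `D⁺` flat-pinned at both (horizontal floor, domain above, radius `ρ`), `D` containing the
PARABOLIC region above the floor near each marked point (one-sided C^{1,1} tangential contact —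
any Dini contact `∫ f(x)/x² < ∞` would do) and equal to `D⁺` off the two balls up to a hull. Then
SLE₈⁄₃(D⁺) stays in `D̄` with positive probability (Warschawski: the angular derivative of
`ℍ ∖ ears → ℍ` at the contact point is finite and non-zero; restriction formula in the limit of
hulls `ears ∖ B(a, 1/n)`) and conditioned on that event it is SLE₈⁄₃(D) (hull restriction + Radó
continuity as the hulls exhaust the ears). -/
def OsculatingRestriction : Prop :=
  ∀ (D Dp : DobrushinDomain) (ρ C : ℝ) (μ : Measure (CurveClass ℂ)), 0 < ρ → 0 ≤ C →
    D.carrier ⊆ Dp.carrier → (∀ i : Fin 2, D.pt i = Dp.pt i) →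
    (∀ i : Fin 2, Dp.carrier ∩ Metric.ball (Dp.pt i) ρ =
      {z : ℂ | (Dp.pt i).im < z.im} ∩ Metric.ball (Dp.pt i) ρ) →
    (∀ i : Fin 2, {z : ℂ | (D.pt i).im + C * (z.re - (D.pt i).re) ^ 2 < z.im} ∩
      Metric.ball (D.pt i) ρ ⊆ D.carrier) →
    Dp.pt 0 ∉ closure ((Dp.carrier \ D.carrier) \ (Metric.ball (Dp.pt 0) ρ ∪ Metric.ball (Dp.pt 1) ρ)) →
    Dp.pt 1 ∉ closure ((Dp.carrier \ D.carrier) \ (Metric.ball (Dp.pt 0) ρ ∪ Metric.ball (Dp.pt 1) ρ)) →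
    IsSLELaw ((8 : ℝ≥0) / 3) Dp μ →
      0 < μ (CurveClass.rangeSubset (closure D.carrier)) ∧
        IsSLELaw ((8 : ℝ≥0) / 3) D
          (ProbabilityTheory.cond μ (CurveClass.rangeSubset (closure D.carrier)))

/-- **The one lattice input of (B): mesoscopic ear avoidance** (a floor-proximity bound of
ShortChordLocality species, inside the flat class). For the flat-pinned `D⁺`-walk between endpoint
approximations of the osculating marked points, the probability of visiting a vertex of the "ears"
`D⁺ ∖ D` within distance `η` of a marked point is small for small `η`, uniformly in the mesh
(no lattice point of the ears is closer than `≍ √δ` to the contact point, so this is a statement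
about scales `√δ … η`). -/
def MesoscopicEarAvoidance : Prop :=
  ∀ (D Dp : DobrushinDomain) (ρ C : ℝ) (a b : ℝ → HexVertex), 0 < ρ → 0 ≤ C →
    D.carrier ⊆ Dp.carrier → (∀ i : Fin 2, D.pt i = Dp.pt i) →
    (∀ i : Fin 2, Dp.carrier ∩ Metric.ball (Dp.pt i) ρ =
      {z : ℂ | (Dp.pt i).im < z.im} ∩ Metric.ball (Dp.pt i) ρ) →
    (∀ i : Fin 2, {z : ℂ | (D.pt i).im + C * (z.re - (D.pt i).re) ^ 2 < z.im} ∩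
      Metric.ball (D.pt i) ρ ⊆ D.carrier) →
    IsEmbEndpointApprox hexGraph hexCenter D a b →
    ∀ ε > (0 : ℝ), ∃ η > (0 : ℝ), ∀ᶠ δ : ℝ in 𝓝[>] 0,
      hexSAWLaw Dp.carrier δ (a δ) (b δ)
        {γ | ∃ v ∈ γ.walk.support, (δ : ℂ) * hexCenter v ∈
          (Dp.carrier \ D.carrier) ∩ (Metric.ball (Dp.pt 0) η ∪ Metric.ball (Dp.pt 1) η)}
        ≤ ENNReal.ofReal ε

/-! ## §5 Shape of the transfer (A), as used by a gate/renewal line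

Given the pointwise floor-class identification in ADMISSIBLE-FAMILY form (the sibling lines' K2 /
`TwoPieceFloorIdentification` WITHOUT any uniformity clause) the uniform statement over the
one-parameter family of hexagon-carved carriers follows for every relative orientation pair except
anti-parallel; recorded here only as the dependency arrow the line card will carry. -/

/-- The dependency arrow of payoff (A) (informal content in the card; typed trivially so that the
line shape is visible): `SubdomainConditioningLaw ∧ TranslationCovariance ∧ ConditioningOnLargeEvents
∧ RangeSubsetOpen ∧ ThinHullProbabilityToOne` are the only ingredients beyond the sibling output. -/
def OuterStabilityIngredients : Prop :=
  SubdomainConditioningLaw ∧ TranslationCovariance ∧ ConditioningOnLargeEvents ∧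
    RangeSubsetOpen ∧ ThinHullProbabilityToOne

/-- Sanity: the crux this serves, by name. -/
example : Summit.CriticalPhenomena.SAWScalingLimit.Theses.SAWDefectDecoherence.ObservableToSLER ↔
    (Summit.CriticalPhenomena.SAWScalingLimit.Theses.SAWDefectDecoherence.HexObservableLimitR →
      Summit.CriticalPhenomena.SAWScalingLimit.Theses.SAWDefectDecoherence.HexTight →
        Summit.CriticalPhenomena.SAWScalingLimit.Theses.SAWDefectDecoherence.HexConjecture) :=
  Iff.rfl

end Summit.CriticalPhenomena.SAWScalingLimit.Cruxes.ObservableToSLER.SubdomainConditioning
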